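import Summits.AtomisticToContinuum.HydrodynamicLimit.Theorems.InformationPercolationEngineKineticClosureBridge
import HarnessLib

/-!
# Line `entropy-floor-fixes-energy` (crux `JParityClosure.ParityBandClosure`, stmt-AtomisticToContinuum-17608),
# stub `stub_energyFloorOfEntropyFloor` — part 1: the deterministic POINTWISE squeeze

Pure real-variable core of the lever "entropy floor at the instant ⇒ energy floor at the instant", one mollification
centre at a time, every junk case of the route's `Hs` (`= 0` off `{ρ > 0, θ > 0}`) handled. §1 Lagrange's identity for
weighted sums in `ℝ³`; §2 for the cone-mollified cell values `(ρ, M, E)`: Cauchy–Schwarz `|M|² ≤ 2Eρ`, vacuum cells,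
and COLD CELLS (`θ ≤ 0 < ρ` + pairwise distinct velocities ⇒ one particle carries positive weight ⇒ `ρ ≤ 3/(πr³n)`);
§3 `pointwise_squeeze` — the tangent inequality of the concave field entropy in the energy variable
(`−θ̃·Hs(ρ,θ) − θ̃·g̃(ρ) + (3/2)ρθ̃ + |M|²/(2ρ) ≤ E`, `g̃(ρ) = ρ(3/2 log θ̃ − log ρ − f_ex(ρσ³))`; on good cells it is
`log x ≤ x − 1` and the `f_ex` terms CANCEL; cold cells need the side condition `g̃(ρ) ≥ (3/2)ρ`); §4 the ONE-SIDED
density step (`ρ log ρ` convex + a Lipschitz bound of `f_ex` on the band) and the momentum completion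
`⟪ũ, M⟫ − ρ|ũ|²/2 ≤ |M|²/(2ρ)`; §5 `pointwise_energy_floor` — one inequality linear in the deviations:
`ψẼ + ψθ̃(Hs(ρ̃,θ̃) − Hs(ρ,θ)) − K|ρ − ρ̃| + ψ⟪ũ, M − ρ̃ũ⟫ ≤ ψE`. No probability, no dynamics, no named fact.
-/

noncomputable section
namespace Summit.AtomisticToContinuum.HydrodynamicLimit.Theorems.ParityBandClosureEnergyFloor

open MeasureTheory Filter Set Topology
open scoped ENNReal InnerProductSpace
open Literature.MathematicalPhysics.KineticTheory Literature.Analysis.FluidPDE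
open Literature.Analysis.FunctionSpaces
open Summit.AtomisticToContinuum.HydrodynamicLimit.Theorems.DensityCapNegative
  (cone cone_nonneg cone_le mollDensity mollDensity_eq mollDensity_nonneg)

/-! ## §1 Lagrange's identity for weighted sums -/

/-- **Lagrange's identity**: `2(Σᵢ bᵢ|vᵢ|²/2)(Σⱼ bⱼ) − |Σᵢ bᵢvᵢ|² = ½ Σᵢ Σⱼ bᵢbⱼ|vᵢ − vⱼ|²`. [folklore] -/
theorem lagrange_weighted {ι : Type*} (s : Finset ι) (b : ι → ℝ) (v : ι → V3) :
    2 * (∑ i ∈ s, b i * (‖v i‖ ^ 2 / 2)) * (∑ j ∈ s, b j) - ‖∑ i ∈ s, b i • v i‖ ^ 2 =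
      2⁻¹ * ∑ i ∈ s, ∑ j ∈ s, b i * b j * ‖v i - v j‖ ^ 2 := by
  have h1 : ‖∑ i ∈ s, b i • v i‖ ^ 2 = ∑ i ∈ s, ∑ j ∈ s, b i * b j * ⟪v i, v j⟫_ℝ := by
    rw [← real_inner_self_eq_norm_sq, sum_inner]
    refine Finset.sum_congr rfl fun i _ => ?_
    rw [inner_sum]
    refine Finset.sum_congr rfl fun j _ => ?_
    rw [real_inner_smul_left, real_inner_smul_right]
    ring
  have h2 : ∀ i j, ‖v i - v j‖ ^ 2 = ‖v i‖ ^ 2 - 2 * ⟪v i, v j⟫_ℝ + ‖v j‖ ^ 2 := fun i j => norm_sub_sq_real _ _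
  have h3 : ∑ i ∈ s, ∑ j ∈ s, b i * b j * ‖v i - v j‖ ^ 2 =
      (∑ i ∈ s, b i * ‖v i‖ ^ 2) * (∑ j ∈ s, b j) + (∑ i ∈ s, b i) * (∑ j ∈ s, b j * ‖v j‖ ^ 2) -
        2 * ∑ i ∈ s, ∑ j ∈ s, b i * b j * ⟪v i, v j⟫_ℝ := by
    simp_rw [h2]
    have e1 : ∑ i ∈ s, ∑ j ∈ s, b i * b j * (‖v i‖ ^ 2 - 2 * ⟪v i, v j⟫_ℝ + ‖v j‖ ^ 2) =
        ∑ i ∈ s, ∑ j ∈ s, (b i * ‖v i‖ ^ 2 * b j + b i * (b j * ‖v j‖ ^ 2) - 2 * (b i * b j * ⟪v i, v j⟫_ℝ)) :=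
      Finset.sum_congr rfl fun i _ => Finset.sum_congr rfl fun j _ => by ring
    have eA : ∑ i ∈ s, ∑ j ∈ s, b i * ‖v i‖ ^ 2 * b j = (∑ i ∈ s, b i * ‖v i‖ ^ 2) * (∑ j ∈ s, b j) := by
      rw [Finset.sum_mul_sum]
    have eB : ∑ i ∈ s, ∑ j ∈ s, b i * (b j * ‖v j‖ ^ 2) = (∑ i ∈ s, b i) * (∑ j ∈ s, b j * ‖v j‖ ^ 2) := by
      rw [Finset.sum_mul_sum]
    have eC : ∑ i ∈ s, ∑ j ∈ s, 2 * (b i * b j * ⟪v i, v j⟫_ℝ) = 2 * ∑ i ∈ s, ∑ j ∈ s, b i * b j * ⟪v i, v j⟫_ℝ := by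
      rw [Finset.mul_sum]
      exact Finset.sum_congr rfl fun i _ => by rw [Finset.mul_sum]
    rw [e1]
    simp only [Finset.sum_sub_distrib, Finset.sum_add_distrib]
    rw [eA, eB, eC]
  rw [h3, h1]
  have e2 : ∑ i ∈ s, b i * (‖v i‖ ^ 2 / 2) = 2⁻¹ * ∑ i ∈ s, b i * ‖v i‖ ^ 2 := by
    rw [Finset.mul_sum]
    exact Finset.sum_congr rfl fun i _ => by ring
  rw [e2]
  ring

/-- Every term of the Lagrange double sum is nonnegative when the weights are. [folklore] -/
theorem lagrange_term_nonneg {ι : Type*} {b : ι → ℝ} (hb : ∀ i, 0 ≤ b i) (v : ι → V3) (i j : ι) :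
    0 ≤ b i * b j * ‖v i - v j‖ ^ 2 := mul_nonneg (mul_nonneg (hb i) (hb j)) (sq_nonneg _)

/-! ## §2 The cone-mollified cell values of a configuration -/

section Cell

variable {n : ℕ} (w : Config n (Fin 3) T3) (r : ℝ) (x : T3)

/-- The mollified momentum at the centre `x` as a weighted sum. [folklore] -/
theorem mollMomentum_eq_sum :
    empiricalMomentumField w (fun y => cone r y x) = (n : ℝ)⁻¹ • ∑ i, cone r (w i).1 x • (w i).2 := empiricalMomentumField_eq_sum w _

/-- The mollified energy at the centre `x` as a weighted sum. [folklore] -/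
theorem mollEnergy_eq_sum :
    empiricalEnergyField w (fun y => cone r y x) = (n : ℝ)⁻¹ * ∑ i, cone r (w i).1 x * (‖(w i).2‖ ^ 2 / 2) := empiricalEnergyField_eq_sum w _

variable {w r x}

/-- **Lagrange for the cell**: `2Eρ − |M|² = (2n²)⁻¹ Σᵢⱼ bᵢbⱼ|vᵢ − vⱼ|²`, cone weights `bᵢ = b_r(qᵢ, x)`. [folklore] -/
theorem cell_lagrange (w : Config n (Fin 3) T3) (r : ℝ) (x : T3) :
    2 * empiricalEnergyField w (fun y => cone r y x) * mollDensity r w x -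
        ‖empiricalMomentumField w (fun y => cone r y x)‖ ^ 2 =
      ((n : ℝ)⁻¹) ^ 2 * (2⁻¹ * ∑ i, ∑ j, cone r (w i).1 x * cone r (w j).1 x * ‖(w i).2 - (w j).2‖ ^ 2) := by
  rw [mollEnergy_eq_sum, mollMomentum_eq_sum, mollDensity_eq, ← lagrange_weighted, norm_smul, Real.norm_eq_abs,
    abs_of_nonneg (inv_nonneg.2 (Nat.cast_nonneg n))]
  ring

/-- **Cauchy–Schwarz for the cell**: `|M|² ≤ 2Eρ` (`0 < r`). [folklore] -/
theorem normSq_mollMomentum_le (hr : 0 < r) (w : Config n (Fin 3) T3) (x : T3) :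
    ‖empiricalMomentumField w (fun y => cone r y x)‖ ^ 2 ≤
      2 * empiricalEnergyField w (fun y => cone r y x) * mollDensity r w x := by
  have h := cell_lagrange w r x
  have hnn : 0 ≤ ((n : ℝ)⁻¹) ^ 2 * (2⁻¹ * ∑ i, ∑ j, cone r (w i).1 x * cone r (w j).1 x * ‖(w i).2 - (w j).2‖ ^ 2) :=
    mul_nonneg (sq_nonneg _) (mul_nonneg (by norm_num) (Finset.sum_nonneg fun i _ => Finset.sum_nonneg fun j _ =>
      lagrange_term_nonneg (fun k => cone_nonneg hr (w k).1 x) (fun k => (w k).2) i j))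
  linarith

/-- The mollified energy is nonnegative (`0 < r`). [folklore] -/
theorem mollEnergy_nonneg (hr : 0 < r) (w : Config n (Fin 3) T3) (x : T3) :
    0 ≤ empiricalEnergyField w (fun y => cone r y x) := by
  rw [mollEnergy_eq_sum]
  exact mul_nonneg (inv_nonneg.2 (Nat.cast_nonneg n))
    (Finset.sum_nonneg fun i _ => mul_nonneg (cone_nonneg hr _ _) (by positivity))

/-- **Vacuum cells**: `ρ = 0 ⇒ M = 0 ∧ E = 0` (all cone weights vanish; `0 < r`, `n ≠ 0`). [folklore] -/
theorem moll_eq_zero_of_density_eq_zero (hr : 0 < r) (hn : n ≠ 0) (w : Config n (Fin 3) T3) (x : T3)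
    (h0 : mollDensity r w x = 0) :
    empiricalMomentumField w (fun y => cone r y x) = 0 ∧ empiricalEnergyField w (fun y => cone r y x) = 0 := by
  have hninv : (n : ℝ)⁻¹ ≠ 0 := inv_ne_zero (by exact_mod_cast hn)
  rw [mollDensity_eq] at h0
  have hsum : ∑ i, cone r (w i).1 x = 0 := by
    rcases mul_eq_zero.1 h0 with h | h
    · exact absurd h hninv
    · exact h
  have hall : ∀ i, cone r (w i).1 x = 0 := fun i =>
    (Finset.sum_eq_zero_iff_of_nonneg fun j _ => cone_nonneg hr (w j).1 x).1 hsum i (Finset.mem_univ i)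
  constructor
  · rw [mollMomentum_eq_sum]
    simp [hall]
  · rw [mollEnergy_eq_sum]
    simp [hall]

/-- **COLD CELLS hold one particle.** If at the centre `x` the mollified density is positive but `2Eρ − |M|² ≤ 0`
(equivalently the cell temperature `θ = (2/3)(E/ρ − |M|²/(2ρ²))` is `≤ 0`), and the velocities of the configuration
are pairwise distinct, then exactly one particle carries positive cone weight, whence `ρ ≤ n⁻¹ · 3/(πr³)`. [folklore] -/
theorem cold_cell_density_le (hr : 0 < r) (w : Config n (Fin 3) T3) (hv : ∀ i j : Fin n, i ≠ j → (w i).2 ≠ (w j).2)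
    (x : T3) (hρ : 0 < mollDensity r w x)
    (hcold : 2 * empiricalEnergyField w (fun y => cone r y x) * mollDensity r w x -
      ‖empiricalMomentumField w (fun y => cone r y x)‖ ^ 2 ≤ 0) :
    mollDensity r w x ≤ (n : ℝ)⁻¹ * (3 / (Real.pi * r ^ 3)) := by
  have hn : n ≠ 0 := by
    rintro rfl
    rw [mollDensity_eq] at hρ
    simp at hρ
  have hnpos : (0 : ℝ) < n := by exact_mod_cast Nat.pos_of_ne_zero hn
  set b : Fin n → ℝ := fun i => cone r (w i).1 x with hbdef
  have hb : ∀ i, 0 ≤ b i := fun i => cone_nonneg hr _ _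
  have hL := cell_lagrange w r x
  have hS0 : ∑ i, ∑ j, b i * b j * ‖(w i).2 - (w j).2‖ ^ 2 ≤ 0 := by
    have hpos : 0 < ((n : ℝ)⁻¹) ^ 2 := by positivity
    by_contra hc
    push Not at hc
    have : 0 < ((n : ℝ)⁻¹) ^ 2 * (2⁻¹ * ∑ i, ∑ j, b i * b j * ‖(w i).2 - (w j).2‖ ^ 2) := by positivity
    linarith
  have hnn : ∀ i, 0 ≤ ∑ j, b i * b j * ‖(w i).2 - (w j).2‖ ^ 2 := fun i =>
    Finset.sum_nonneg fun j _ => lagrange_term_nonneg hb (fun k => (w k).2) i j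
  have hS : ∑ i, ∑ j, b i * b j * ‖(w i).2 - (w j).2‖ ^ 2 = 0 :=
    le_antisymm hS0 (Finset.sum_nonneg fun i _ => hnn i)
  have hterm : ∀ i j, b i * b j * ‖(w i).2 - (w j).2‖ ^ 2 = 0 := fun i j =>
    (Finset.sum_eq_zero_iff_of_nonneg fun j _ => lagrange_term_nonneg hb (fun k => (w k).2) i j).1
      ((Finset.sum_eq_zero_iff_of_nonneg fun i _ => hnn i).1 hS i (Finset.mem_univ i)) j (Finset.mem_univ j)
  have hpair : ∀ i j, i ≠ j → b i = 0 ∨ b j = 0 := by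
    intro i j hij
    have h := hterm i j
    have hvij : ‖(w i).2 - (w j).2‖ ^ 2 ≠ 0 := by
      have : (w i).2 - (w j).2 ≠ 0 := sub_ne_zero.2 (hv i j hij)
      positivity
    rcases mul_eq_zero.1 h with h' | h'
    · exact mul_eq_zero.1 h'
    · exact absurd h' hvij
  -- a particle with positive weight exists
  rw [mollDensity_eq] at hρ ⊢
  obtain ⟨i₀, -, hi₀⟩ : ∃ i₀ ∈ Finset.univ, 0 < b i₀ := by
    by_contra hc
    push Not at hc
    have : ∑ i, b i ≤ 0 := Finset.sum_nonpos fun i hi => hc i hi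
    have h2 : (n : ℝ)⁻¹ * ∑ i, b i ≤ 0 := mul_nonpos_of_nonneg_of_nonpos (inv_nonneg.2 hnpos.le) this
    exact absurd hρ (not_lt.2 h2)
  have hothers : ∀ j, j ≠ i₀ → b j = 0 := fun j hj => by
    rcases hpair j i₀ hj with h | h
    · exact h
    · exact absurd h hi₀.ne'
  have hsum : ∑ i, b i = b i₀ := by
    rw [← Finset.add_sum_erase _ _ (Finset.mem_univ i₀)]
    rw [Finset.sum_eq_zero fun j hj => hothers j (Finset.ne_of_mem_erase hj), add_zero]
  change (n : ℝ)⁻¹ * ∑ i, b i ≤ (n : ℝ)⁻¹ * (3 / (Real.pi * r ^ 3))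
  rw [hsum]
  exact mul_le_mul_of_nonneg_left (cone_le hr _ _) (inv_nonneg.2 hnpos.le)

end Cell

/-! ## §3 The pointwise squeeze (tangent in the energy variable, junk cases included) -/

/-- **The pointwise squeeze.** For a cell with values `(ρ, M, E)`, `ρ ≥ 0`, `|M|² ≤ 2Eρ`, vacuum consistency
(`ρ = 0 ⇒ M = 0 ∧ E = 0`), reference temperature `θ̃ > 0`, and the cold-cell side condition
(`θ ≤ 0 < ρ ⇒ (3/2)ρ ≤ g̃(ρ)`): with `θ = (2/3)(E/ρ − |M|²/(2ρ²))`, the route's `Hs` and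
`g̃(ρ) = ρ(3/2 log θ̃ − log ρ − f_ex(ρσ³))`,
`−θ̃·Hs(ρ, θ) − θ̃·g̃(ρ) + (3/2)ρθ̃ + |M|²/(2ρ) ≤ E`. On good cells it is `log(θ/θ̃) ≤ θ/θ̃ − 1` (the
configurational terms cancel exactly). [folklore] -/
theorem pointwise_squeeze (σ : ℝ) {θt ρ E : ℝ} {M : V3} (hθt : 0 < θt) (hρ : 0 ≤ ρ)
    (hcs : ‖M‖ ^ 2 ≤ 2 * E * ρ) (hzero : ρ = 0 → M = 0 ∧ E = 0)
    (hJ : 2 / 3 * (E / ρ - ‖M‖ ^ 2 / (2 * ρ ^ 2)) ≤ 0 → 0 < ρ →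
      3 / 2 * ρ ≤ ρ * (3 / 2 * Real.log θt - Real.log ρ - hsExcessFreeEnergy (ρ * σ ^ 3))) :
    -θt * (if 0 < ρ ∧ 0 < 2 / 3 * (E / ρ - ‖M‖ ^ 2 / (2 * ρ ^ 2)) then
        -(ρ * (3 / 2 * Real.log (2 / 3 * (E / ρ - ‖M‖ ^ 2 / (2 * ρ ^ 2))) - Real.log ρ -
          hsExcessFreeEnergy (ρ * σ ^ 3))) else 0) -
      θt * (ρ * (3 / 2 * Real.log θt - Real.log ρ - hsExcessFreeEnergy (ρ * σ ^ 3))) +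
      3 / 2 * ρ * θt + ‖M‖ ^ 2 / (2 * ρ) ≤ E := by
  set θ : ℝ := 2 / 3 * (E / ρ - ‖M‖ ^ 2 / (2 * ρ ^ 2)) with hθdef
  rcases hρ.lt_or_eq with hρpos | hρ0
  · by_cases hθ : 0 < θ
    · -- good cell: the tangent inequality `log (θ/θt) ≤ θ/θt - 1`
      rw [if_pos ⟨hρpos, hθ⟩]
      have hE : E = 3 / 2 * ρ * θ + ‖M‖ ^ 2 / (2 * ρ) := by
        rw [hθdef]
        field_simp
        ring
      have hlog : Real.log θ - Real.log θt ≤ θ / θt - 1 := by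
        rw [← Real.log_div hθ.ne' hθt.ne']
        exact Real.log_le_sub_one_of_pos (div_pos hθ hθt)
      have key : θt * (Real.log θ - Real.log θt) ≤ θ - θt := by
        have h := mul_le_mul_of_nonneg_left hlog hθt.le
        have e : θt * (θ / θt - 1) = θ - θt := by field_simp
        linarith [h, e]
      have h32 : (0 : ℝ) ≤ 3 / 2 * ρ := by positivity
      nlinarith [mul_le_mul_of_nonneg_left key h32]
    · -- cold cell: `Hs = 0`, the side condition and Cauchy–Schwarz
      rw [if_neg (fun h => hθ h.2)]
      have hθle : θ ≤ 0 := not_lt.1 hθ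
      have hJ' := hJ hθle hρpos
      have hkin : ‖M‖ ^ 2 / (2 * ρ) ≤ E := by
        rw [div_le_iff₀ (by positivity)]
        linarith
      nlinarith [mul_le_mul_of_nonneg_left hJ' hθt.le]
  · -- vacuum cell
    subst hρ0
    obtain ⟨hM, hE⟩ := hzero rfl
    subst hM; subst hE
    simp

/-! ## §4 The one-sided density step and the momentum completion -/

/-- Tangent inequality of the convex `x log x` at `y > 0`: `y log y + (log y + 1)(x − y) ≤ x log x`. [folklore] -/
theorem mul_log_tangent {x y : ℝ} (hx : 0 ≤ x) (hy : 0 < y) :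
    y * Real.log y + (Real.log y + 1) * (x - y) ≤ x * Real.log x := by
  rcases hx.lt_or_eq with hxpos | hx0
  · -- `x log (x/y) ≥ x - y`
    have h1 : 1 - y / x ≤ Real.log (x / y) := by
      have h := Real.one_sub_inv_le_log_of_pos (div_pos hxpos hy)
      rwa [inv_div] at h
    have h2 : Real.log (x / y) = Real.log x - Real.log y := Real.log_div hxpos.ne' hy.ne'
    rw [h2] at h1
    have h3 := mul_le_mul_of_nonneg_left h1 hxpos.le
    rw [mul_sub, mul_one, mul_div_cancel₀ _ hxpos.ne'] at h3
    nlinarith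
  · subst hx0
    simp only [zero_sub, mul_neg, Real.log_zero, mul_zero]
    nlinarith

/-- **One-sided density step.** With `g̃(ρ) = ρ(c − log ρ − f_ex(ρσ³))`, `c = 3/2 log θ̃`, a reference density
`ρ̃ > 0`, a sup bound `|f_ex| ≤ B` and a Lipschitz bound `|f_ex a − f_ex b| ≤ L|a − b|` on the band `[0, ηb]`
containing `ρσ³` and `ρ̃σ³`: `g̃(ρ) − g̃(ρ̃) ≤ (|c| + |log ρ̃| + 1 + B + ρ̃σ³L)·|ρ − ρ̃|` — the concave part by the
tangent at `ρ̃`, the configurational part by the Lipschitz bound; no lower bound on `ρ` is needed. [folklore] -/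
theorem density_step_one_sided {σ c ρ ρt ηb B L : ℝ} (hσ : 0 ≤ σ) (hρ : 0 ≤ ρ) (hρt : 0 < ρt)
    (hB : ∀ a ∈ Set.Icc (0 : ℝ) ηb, |hsExcessFreeEnergy a| ≤ B)
    (hL : ∀ a ∈ Set.Icc (0 : ℝ) ηb, ∀ b ∈ Set.Icc (0 : ℝ) ηb, |hsExcessFreeEnergy a - hsExcessFreeEnergy b| ≤ L * |a - b|)
    (hρb : ρ * σ ^ 3 ≤ ηb) (hρtb : ρt * σ ^ 3 ≤ ηb) :
    ρ * (c - Real.log ρ - hsExcessFreeEnergy (ρ * σ ^ 3)) - ρt * (c - Real.log ρt - hsExcessFreeEnergy (ρt * σ ^ 3)) ≤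
      (|c| + |Real.log ρt| + 1 + B + ρt * σ ^ 3 * L) * |ρ - ρt| := by
  have hσ3 : 0 ≤ σ ^ 3 := pow_nonneg hσ 3
  have hmemρ : ρ * σ ^ 3 ∈ Set.Icc (0 : ℝ) ηb := ⟨mul_nonneg hρ hσ3, hρb⟩
  have hmemρt : ρt * σ ^ 3 ∈ Set.Icc (0 : ℝ) ηb := ⟨mul_nonneg hρt.le hσ3, hρtb⟩
  -- concave part
  have h1 : ρ * (c - Real.log ρ) - ρt * (c - Real.log ρt) ≤ (|c| + |Real.log ρt| + 1) * |ρ - ρt| := by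
    have ht := mul_log_tangent hρ hρt
    have e : ρ * (c - Real.log ρ) - ρt * (c - Real.log ρt) =
        c * (ρ - ρt) - (ρ * Real.log ρ - ρt * Real.log ρt) := by ring
    rw [e]
    have h2 : c * (ρ - ρt) - (ρ * Real.log ρ - ρt * Real.log ρt) ≤ (c - Real.log ρt - 1) * (ρ - ρt) := by nlinarith
    refine h2.trans ?_
    calc (c - Real.log ρt - 1) * (ρ - ρt) ≤ |(c - Real.log ρt - 1) * (ρ - ρt)| := le_abs_self _
      _ = |c - Real.log ρt - 1| * |ρ - ρt| := abs_mul _ _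
      _ ≤ (|c| + |Real.log ρt| + 1) * |ρ - ρt| := by
          refine mul_le_mul_of_nonneg_right ?_ (abs_nonneg _)
          calc |c - Real.log ρt - 1| ≤ |c - Real.log ρt| + |(1 : ℝ)| := abs_sub _ _
            _ ≤ |c| + |Real.log ρt| + 1 := by rw [abs_one]; linarith [abs_sub c (Real.log ρt)]
  -- configurational part
  have h2 : -(ρ * hsExcessFreeEnergy (ρ * σ ^ 3)) + ρt * hsExcessFreeEnergy (ρt * σ ^ 3) ≤
      (B + ρt * σ ^ 3 * L) * |ρ - ρt| := by
    have e : -(ρ * hsExcessFreeEnergy (ρ * σ ^ 3)) + ρt * hsExcessFreeEnergy (ρt * σ ^ 3) =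
        -((ρ - ρt) * hsExcessFreeEnergy (ρ * σ ^ 3)) -
          ρt * (hsExcessFreeEnergy (ρ * σ ^ 3) - hsExcessFreeEnergy (ρt * σ ^ 3)) := by ring
    rw [e]
    have hA : -((ρ - ρt) * hsExcessFreeEnergy (ρ * σ ^ 3)) ≤ B * |ρ - ρt| := by
      calc -((ρ - ρt) * hsExcessFreeEnergy (ρ * σ ^ 3)) ≤ |(ρ - ρt) * hsExcessFreeEnergy (ρ * σ ^ 3)| := neg_le_abs _
        _ = |ρ - ρt| * |hsExcessFreeEnergy (ρ * σ ^ 3)| := abs_mul _ _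
        _ ≤ |ρ - ρt| * B := mul_le_mul_of_nonneg_left (hB _ hmemρ) (abs_nonneg _)
        _ = B * |ρ - ρt| := mul_comm _ _
    have hC : -(ρt * (hsExcessFreeEnergy (ρ * σ ^ 3) - hsExcessFreeEnergy (ρt * σ ^ 3))) ≤ ρt * σ ^ 3 * L * |ρ - ρt| := by
      have hl := hL _ hmemρ _ hmemρt
      rw [show ρ * σ ^ 3 - ρt * σ ^ 3 = (ρ - ρt) * σ ^ 3 by ring, abs_mul, abs_of_nonneg hσ3] at hl
      calc -(ρt * (hsExcessFreeEnergy (ρ * σ ^ 3) - hsExcessFreeEnergy (ρt * σ ^ 3)))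
          ≤ |ρt * (hsExcessFreeEnergy (ρ * σ ^ 3) - hsExcessFreeEnergy (ρt * σ ^ 3))| := neg_le_abs _
        _ = ρt * |hsExcessFreeEnergy (ρ * σ ^ 3) - hsExcessFreeEnergy (ρt * σ ^ 3)| := by
            rw [abs_mul, abs_of_pos hρt]
        _ ≤ ρt * (L * (|ρ - ρt| * σ ^ 3)) := mul_le_mul_of_nonneg_left hl hρt.le
        _ = ρt * σ ^ 3 * L * |ρ - ρt| := by ring
    linarith
  have e3 : ρ * (c - Real.log ρ - hsExcessFreeEnergy (ρ * σ ^ 3)) - ρt * (c - Real.log ρt - hsExcessFreeEnergy (ρt * σ ^ 3)) =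
      (ρ * (c - Real.log ρ) - ρt * (c - Real.log ρt)) +
        (-(ρ * hsExcessFreeEnergy (ρ * σ ^ 3)) + ρt * hsExcessFreeEnergy (ρt * σ ^ 3)) := by ring
  rw [e3]
  calc _ ≤ (|c| + |Real.log ρt| + 1) * |ρ - ρt| + (B + ρt * σ ^ 3 * L) * |ρ - ρt| := add_le_add h1 h2
    _ = (|c| + |Real.log ρt| + 1 + B + ρt * σ ^ 3 * L) * |ρ - ρt| := by ring

/-- **Momentum completion**: `⟪ũ, M⟫ − ρ|ũ|²/2 ≤ |M|²/(2ρ)` for `ρ ≥ 0` (vacuum consistency `ρ = 0 ⇒ M = 0` for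
the junk value `|M|²/0 = 0`). It is `|M − ρũ|² ≥ 0`. [folklore] -/
theorem momentum_completion {ρ : ℝ} (hρ : 0 ≤ ρ) (M u : V3) (hzero : ρ = 0 → M = 0) :
    ⟪u, M⟫_ℝ - ρ * ‖u‖ ^ 2 / 2 ≤ ‖M‖ ^ 2 / (2 * ρ) := by
  rcases hρ.lt_or_eq with hρpos | hρ0
  · have h := norm_sub_sq_real M (ρ • u)
    have hnn : 0 ≤ ‖M - ρ • u‖ ^ 2 := sq_nonneg _
    rw [norm_smul, Real.norm_eq_abs, abs_of_pos hρpos, real_inner_smul_right, real_inner_comm] at h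
    rw [le_div_iff₀ (by positivity)]
    nlinarith
  · subst hρ0
    have hM : M = 0 := hzero rfl
    subst hM
    simp

/-! ## §5 The assembled pointwise inequality -/

/-- **Pointwise energy floor.** At one centre: weight `ψ ≥ 0`, reference state `(ρ̃ > 0, ũ, θ̃ > 0)`, cell values
`(ρ, M, E)` with `ρ ≥ 0`, `|M|² ≤ 2Eρ`, vacuum consistency and the cold-cell side condition, band data
(`|f_ex| ≤ B`, `f_ex` `L`-Lipschitz on `[0, ηb] ∋ ρσ³, ρ̃σ³`). Then
`ψ·Ẽ + ψθ̃·(Hs(ρ̃, θ̃) − Hs(ρ, θ)) − K·|ρ − ρ̃| + ψ⟪ũ, M − ρ̃ũ⟫ ≤ ψ·E`,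
`Ẽ = ρ̃(|ũ|²/2 + 3θ̃/2)`, `K = ψ(θ̃(3/2|log θ̃| + |log ρ̃| + 1 + B + ρ̃σ³L) + 3θ̃/2 + |ũ|²/2)`. [folklore] -/
theorem pointwise_energy_floor (σ : ℝ) (hσ : 0 ≤ σ) {ψ θt ρt ρ E ηb B L : ℝ} {ut M : V3} (hψ : 0 ≤ ψ)
    (hθt : 0 < θt) (hρt : 0 < ρt) (hρ : 0 ≤ ρ)
    (hcs : ‖M‖ ^ 2 ≤ 2 * E * ρ) (hzero : ρ = 0 → M = 0 ∧ E = 0)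
    (hJ : 2 / 3 * (E / ρ - ‖M‖ ^ 2 / (2 * ρ ^ 2)) ≤ 0 → 0 < ρ →
      3 / 2 * ρ ≤ ρ * (3 / 2 * Real.log θt - Real.log ρ - hsExcessFreeEnergy (ρ * σ ^ 3)))
    (hB : ∀ a ∈ Set.Icc (0 : ℝ) ηb, |hsExcessFreeEnergy a| ≤ B)
    (hL : ∀ a ∈ Set.Icc (0 : ℝ) ηb, ∀ b ∈ Set.Icc (0 : ℝ) ηb, |hsExcessFreeEnergy a - hsExcessFreeEnergy b| ≤ L * |a - b|)
    (hρb : ρ * σ ^ 3 ≤ ηb) (hρtb : ρt * σ ^ 3 ≤ ηb) :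
    let Hs : ℝ → ℝ → ℝ := fun a b =>
      if 0 < a ∧ 0 < b then -(a * (3 / 2 * Real.log b - Real.log a - hsExcessFreeEnergy (a * σ ^ 3))) else 0
    ψ * totalEnergyDensity ρt ut θt +
      ψ * θt * (Hs ρt θt - Hs ρ (2 / 3 * (E / ρ - ‖M‖ ^ 2 / (2 * ρ ^ 2)))) -
      ψ * (θt * (3 / 2 * |Real.log θt| + |Real.log ρt| + 1 + B + ρt * σ ^ 3 * L) + 3 / 2 * θt + ‖ut‖ ^ 2 / 2) *
        |ρ - ρt| +
      ψ * ⟪ut, M - ρt • ut⟫_ℝ ≤ ψ * E := by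
  intro Hs
  -- the three ingredients
  have hsq := pointwise_squeeze σ hθt hρ hcs hzero hJ
  have hden := density_step_one_sided (c := 3 / 2 * Real.log θt) hσ hρ hρt hB hL hρb hρtb
  have hmom := momentum_completion hρ M ut (fun h => (hzero h).1)
  -- the reference entropy
  have hHt : Hs ρt θt = -(ρt * (3 / 2 * Real.log θt - Real.log ρt - hsExcessFreeEnergy (ρt * σ ^ 3))) := by
    simp only [Hs, if_pos (And.intro hρt hθt)]
  have hHρ : Hs ρ (2 / 3 * (E / ρ - ‖M‖ ^ 2 / (2 * ρ ^ 2))) =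
      (if 0 < ρ ∧ 0 < 2 / 3 * (E / ρ - ‖M‖ ^ 2 / (2 * ρ ^ 2)) then
        -(ρ * (3 / 2 * Real.log (2 / 3 * (E / ρ - ‖M‖ ^ 2 / (2 * ρ ^ 2))) - Real.log ρ -
          hsExcessFreeEnergy (ρ * σ ^ 3))) else 0) := rfl
  have hEt : totalEnergyDensity ρt ut θt = ρt * (‖ut‖ ^ 2 / 2 + 3 / 2 * θt) := rfl
  have hinner : ⟪ut, M - ρt • ut⟫_ℝ = ⟪ut, M⟫_ℝ - ρt * ‖ut‖ ^ 2 := by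
    rw [inner_sub_right, real_inner_smul_right, real_inner_self_eq_norm_sq]
  have habs : |3 / 2 * Real.log θt| = 3 / 2 * |Real.log θt| := by
    rw [abs_mul, abs_of_pos (by norm_num : (0 : ℝ) < 3 / 2)]
  rw [hHt, hHρ, hEt, hinner]
  rw [habs] at hden
  -- bookkeeping: every remaining term is linear in `ρ - ρt`, bounded by `|ρ - ρt|`
  have hlin1 : 3 / 2 * θt * (ρ - ρt) ≥ -(3 / 2 * θt * |ρ - ρt|) := by
    have := neg_abs_le (ρ - ρt)
    nlinarith
  have hlin2 : -(‖ut‖ ^ 2 / 2 * (ρ - ρt)) ≥ -(‖ut‖ ^ 2 / 2 * |ρ - ρt|) := by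
    have := le_abs_self (ρ - ρt)
    have h0 : 0 ≤ ‖ut‖ ^ 2 / 2 := by positivity
    nlinarith
  have hθtden := mul_le_mul_of_nonneg_left hden hθt.le
  -- assemble (multiply the unweighted inequality by `ψ ≥ 0`)
  have core : totalEnergyDensity ρt ut θt +
      θt * (-(ρt * (3 / 2 * Real.log θt - Real.log ρt - hsExcessFreeEnergy (ρt * σ ^ 3))) -
        (if 0 < ρ ∧ 0 < 2 / 3 * (E / ρ - ‖M‖ ^ 2 / (2 * ρ ^ 2)) then
          -(ρ * (3 / 2 * Real.log (2 / 3 * (E / ρ - ‖M‖ ^ 2 / (2 * ρ ^ 2))) - Real.log ρ -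
            hsExcessFreeEnergy (ρ * σ ^ 3))) else 0)) -
      (θt * (3 / 2 * |Real.log θt| + |Real.log ρt| + 1 + B + ρt * σ ^ 3 * L) + 3 / 2 * θt + ‖ut‖ ^ 2 / 2) *
        |ρ - ρt| +
      (⟪ut, M⟫_ℝ - ρt * ‖ut‖ ^ 2) ≤ E := by
    rw [hEt]
    nlinarith [hsq, hθtden, hmom, hlin1, hlin2]
  have := mul_le_mul_of_nonneg_left core hψ
  nlinarith [this]

/-- **Registered sub-goal** (helper 1/3 of `stub_energyFloorOfEntropyFloor`): tangent of the convex `x log x`. [folklore] -/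
theorem stub_energyFloorDensityTangent : ∀ {x y : ℝ}, 0 ≤ x → 0 < y → y * Real.log y + (Real.log y + 1) * (x - y) ≤ x * Real.log x :=
  fun hx hy => mul_log_tangent hx hy
end Summit.AtomisticToContinuum.HydrodynamicLimit.Theorems.ParityBandClosureEnergyFloor

end
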